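import Summits.SmoothPoincare4.SmoothPoincare4.Theorems.ConvexBisectionAcyclicBisectionExistsBeltMonodromySeamLift
import Summits.SmoothPoincare4.SmoothPoincare4.Theorems.ConvexBisectionAcyclicBisectionExistsBeltMonodromySlopeBelt
import Summits.SmoothPoincare4.SmoothPoincare4.Theorems.ConvexBisectionAcyclicBisectionExistsBeltMonodromyPages
import Literature.Topology.FourManifolds.HandleAttachingMapsAssoc
import HarnessLib

/-!
# N1 ▸ `node_N1_move` ▸ (d) N1-mono (the deep-belt monodromy model), brick J1-(d5):
# THE TRANSIT — the seam-lift chart read in belt tube coordinates (gluing in chart coordinates)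
(wave 8, crux stmt-SmoothPoincare4-10508, line `modp-braid-orbits`, registered stub `stub_M2geo` (N1) ▸
`node_N1_move` ▸ sub-node (d) = H4's `helper_N1_beltMonodromy`; geometric dictionary of piece (d5) of
`work/stubs/H4-REPORT.md` §4; registered sub-goal `helper_beltGlue_transit`)

In the telescope of `node_N1_move` (boundary datum `bX` of the ORIGINAL piece `X₀`, `G₀ : X₀ ≅ X`, data `D` of `X`
over the attaching maps `h`, seam and belt clauses through `G₀`) the two immersions of `ℝ³` into `∂X₀` of (d) are
H4-3's BELT CHART and H4-8's SEAM-LIFT CHART of the input chart family `φ`,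

    B (u, m) := T (β♭ (e^{2πiu}, m)),        Λ₀ p := T (seamLift D (∂X) (Ψ ∘ T) (lift (φ p))),

`T := ∂(G₀⁻¹)`, `β♭ :=` the belt tube of handle `k`.  This file names them (`beltChartFlat`, `seamLiftChart`), names
the BELT LEVEL `Q := arctan ∘ Sl` (`beltLevel`; `Sl` = H4-4's belt slope) and the TRANSIT

    χ̂ p := β♭⁻¹ (T⁻¹ (Λ₀ p)) ∈ S¹ × ℝ²      (`transit`: the seam-lift chart read in belt tube coordinates),

and proves the dictionary between the flat analytic layer (pieces (d6) `…BeltMonodromyField`, (d7)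
`…BeltMonodromyFlow`, in flat belt coordinates `(u, m) ∈ ℝ × ℝ²`) and the geometry:
* §2 BELT COORDINATES of a belt-region point `y` (`G₀ (bX.incl y) ∈ range (beltMap D k)`): `B (u, m) = y` for
  `(e^{2πiu}, m) = β♭⁻¹ (T⁻¹ y)`, `‖m‖ < 1`;
* §3 LIFT `B (u, (χ̂ p).2) = Λ₀ p` whenever `e^{2πiu} = (χ̂ p).1`; FIBRED: `conj (d k) · w (Ψ (Λ₀ p)) = t e^{iσ}`,
  `t > 0`, hence positive denominator and `Q (u, (χ̂ p).2) = σ` (`|σ| < π/2`) — the chart levels ARE the belt levels;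
* §4 INJECTIVE: `χ̂ p = χ̂ p'` forces the same level and the same chart point (`D.jA` injective, pages of distinct
  directions disjoint), so `p ≡ p'` modulo the period by the level-wise injectivity of `φ`;
* §5 SMOOTH: `χ̂` is `C^∞` at every box point off the cores whose seam lift is in the belt region, and so are its
  flat components `(χ̂ p).2 ∈ ℝ²`, `((χ̂ p).1 : ℝ²)`;
* §6 IMMERSION in flat form: for any global section `ang` of `e^{2πi·}` smooth at `(χ̂ p).1` (the tree's `angA`/`angB`),
  the flat transit `F p := (ang (χ̂ p).1, (χ̂ p).2)` satisfies `B ∘ F = Λ₀` near `p` and has INJECTIVE (so bijective)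
  differential at `p` — the local inverses of `F` are the chart-coordinate functions on the belt (pieces (d5′), (d8)).

Four small definitions (names for the recurring terms; all properties are theorems).  Everything is proved; no named
facts, no `sorry`.  References: A. A. Kosinski, *Differential Manifolds* (1993), VI §6 [Kosinski1993]; J. M. Lee,
*Introduction to Smooth Manifolds* (2012), Thm. 4.25, Thm. 5.11 [LeeSmoothManifolds2013].
-/

noncomputable section

set_option linter.dupNamespace false

open scoped Manifold ContDiff Topology ComplexConjugate
open Set Function Metric Complex Filter
open Literature.Topology.FourManifolds Literature.Topology.FourManifolds.HandleAttachingMap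
  Literature.Topology.FourManifolds.LefschetzBase

namespace Summit.SmoothPoincare4.SmoothPoincare4.Theorems.AcyclicBisectionExists.ModpBraidOrbits

/-! ## §1 The four named terms -/

section Defs

variable {g n : ℕ} {h : Fin n → HandleAttachingMap 3 2 (Base g)}
  {X₀ : Type} [TopologicalSpace X₀] [ChartedSpace (EuclideanHalfSpace 4) X₀]
  (bX : BoundaryData (𝓡∂ 4) X₀ (𝓡 3)) (Ψ : bX.carrier ≃ₘ⟮𝓡 3, 𝓡 3⟯ (bBase g).carrier)
  {X : Type} [TopologicalSpace X] [ChartedSpace (EuclideanHalfSpace 4) X] [IsManifold (𝓡∂ 4) ∞ X]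
  (G₀ : X₀ ≃ₘ⟮𝓡∂ 4, 𝓡∂ 4⟯ X) (D : MultiAttachmentData h (𝓡∂ 4) X) (d : Fin n → ℂ) (k : Fin n)

/-- **The belt chart in flat belt coordinates** `B (u, m) := ∂(G₀⁻¹) (β♭ (e^{2πiu}, m))` (H4-3).
[cite: Kosinski1993, VI §6] -/
def beltChartFlat (p : ℝ × EuclideanSpace ℝ (Fin 2)) : bX.carrier :=
  (BoundaryManifold.boundaryData 3 X).restrictDiffeomorph bX G₀.symm
    ((beltMap D k).boundaryTube.toHomeo (circlePt p.1, p.2))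

/-- Unfolding `beltChartFlat`. [folklore] -/
theorem beltChartFlat_apply (p : ℝ × EuclideanSpace ℝ (Fin 2)) :
    beltChartFlat bX G₀ D k p = (BoundaryManifold.boundaryData 3 X).restrictDiffeomorph bX G₀.symm
      ((beltMap D k).boundaryTube.toHomeo (circlePt p.1, p.2)) := rfl

/-- The flat belt chart is `1`-periodic in `u`. [folklore] -/
theorem beltChartFlat_add_one (u : ℝ) (m : EuclideanSpace ℝ (Fin 2)) :
    beltChartFlat bX G₀ D k (u + 1, m) = beltChartFlat bX G₀ D k (u, m) := by
  simp only [beltChartFlat_apply, circlePt_add_one]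

/-- **The belt level** `Q := arctan ∘ Sl`, `Sl (u, m) := Im (c̄ W) / Re (c̄ W)`, `W := w (Ψ (B (u, m)))`, `c := d k`
(H4-4's belt slope made an angle). [cite: Kosinski1993, VI §6] -/
def beltLevel (p : ℝ × EuclideanSpace ℝ (Fin 2)) : ℝ :=
  Real.arctan (((starRingEnd ℂ) (d k) * w g ((bBase g).incl (Ψ (beltChartFlat bX G₀ D k p))).1).im /
    ((starRingEnd ℂ) (d k) * w g ((bBase g).incl (Ψ (beltChartFlat bX G₀ D k p))).1).re)

/-- Unfolding `beltLevel`. [folklore] -/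
theorem beltLevel_apply (p : ℝ × EuclideanSpace ℝ (Fin 2)) :
    beltLevel bX Ψ G₀ D d k p =
      Real.arctan (((starRingEnd ℂ) (d k) * w g ((bBase g).incl (Ψ (beltChartFlat bX G₀ D k p))).1).im /
        ((starRingEnd ℂ) (d k) * w g ((bBase g).incl (Ψ (beltChartFlat bX G₀ D k p))).1).re) := rfl

/-- The belt level is `1`-periodic in `u`. [folklore] -/
theorem beltLevel_add_one (u : ℝ) (m : EuclideanSpace ℝ (Fin 2)) :
    beltLevel bX Ψ G₀ D d k (u + 1, m) = beltLevel bX Ψ G₀ D d k (u, m) := by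
  simp only [beltLevel_apply, beltChartFlat_add_one]

variable [Nonempty (bBase g).carrier] [Nonempty (BoundaryManifold.boundaryData 3 X).carrier]

/-- **The seam-lift chart** `Λ₀ p := ∂(G₀⁻¹) (seamLift D (∂X) (Ψ ∘ ∂(G₀⁻¹)) (lift (φ p)))` of the chart family `φ`
(H4-8). [cite: Kosinski1993, VI §6] -/
def seamLiftChart (φ : ℝ × ℝ × ℝ → Base g) (p : ℝ × ℝ × ℝ) : bX.carrier :=
  (BoundaryManifold.boundaryData 3 X).restrictDiffeomorph bX G₀.symm
    (seamLift D (BoundaryManifold.boundaryData 3 X)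
      (((BoundaryManifold.boundaryData 3 X).restrictDiffeomorph bX G₀.symm).trans Ψ) ((bBase g).inclInv (φ p)))

/-- Unfolding `seamLiftChart`. [folklore] -/
theorem seamLiftChart_apply (φ : ℝ × ℝ × ℝ → Base g) (p : ℝ × ℝ × ℝ) :
    seamLiftChart bX Ψ G₀ D φ p = (BoundaryManifold.boundaryData 3 X).restrictDiffeomorph bX G₀.symm
      (seamLift D (BoundaryManifold.boundaryData 3 X)
        (((BoundaryManifold.boundaryData 3 X).restrictDiffeomorph bX G₀.symm).trans Ψ) ((bBase g).inclInv (φ p))) :=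
  rfl

/-- **The transit** `χ̂ p := β♭⁻¹ (∂(G₀⁻¹)⁻¹ (Λ₀ p)) ∈ S¹ × ℝ²`: the seam-lift chart read in the belt tube coordinates
of handle `k`. [cite: Kosinski1993, VI §6] -/
def transit (φ : ℝ × ℝ × ℝ → Base g) (p : ℝ × ℝ × ℝ) :
    Metric.sphere (0 : EuclideanSpace ℝ (Fin 2)) 1 × EuclideanSpace ℝ (Fin 2) :=
  (beltMap D k).boundaryTube.toHomeo.symm
    (((BoundaryManifold.boundaryData 3 X).restrictDiffeomorph bX G₀.symm).symm (seamLiftChart bX Ψ G₀ D φ p))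

/-- Unfolding `transit`. [folklore] -/
theorem transit_apply (φ : ℝ × ℝ × ℝ → Base g) (p : ℝ × ℝ × ℝ) :
    transit bX Ψ G₀ D k φ p = (beltMap D k).boundaryTube.toHomeo.symm
      (((BoundaryManifold.boundaryData 3 X).restrictDiffeomorph bX G₀.symm).symm (seamLiftChart bX Ψ G₀ D φ p)) := rfl

end Defs

/-! ## §2 Belt coordinates of a belt-region point -/

section BeltCoord

variable {g n : ℕ} {h : Fin n → HandleAttachingMap 3 2 (Base g)}
  {X₀ : Type} [TopologicalSpace X₀] [ChartedSpace (EuclideanHalfSpace 4) X₀]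
  (bX : BoundaryData (𝓡∂ 4) X₀ (𝓡 3))
  {X : Type} [TopologicalSpace X] [ChartedSpace (EuclideanHalfSpace 4) X] [IsManifold (𝓡∂ 4) ∞ X]
  (G₀ : X₀ ≃ₘ⟮𝓡∂ 4, 𝓡∂ 4⟯ X) (D : MultiAttachmentData h (𝓡∂ 4) X) (k : Fin n)

/-- A belt-region point of `∂X₀`, read in `∂X` through `T⁻¹ := ∂(G₀⁻¹)⁻¹`, lies in the target of the belt tube.
[folklore] -/
theorem symm_mem_boundaryTube_target {y : bX.carrier} (hy : G₀ (bX.incl y) ∈ range (beltMap D k).toFun) :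
    ((((BoundaryManifold.boundaryData 3 X).restrictDiffeomorph bX G₀.symm).symm y : ↥((𝓡∂ 4).boundary X))) ∈
      (beltMap D k).boundaryTube.toHomeo.target := by
  set z : ↥((𝓡∂ 4).boundary X) := ((BoundaryManifold.boundaryData 3 X).restrictDiffeomorph bX G₀.symm).symm y with hz
  have hzX : (z : X) = G₀ (bX.incl y) := by
    have e := G₀_incl_restrict bX G₀ z
    rw [hz, Diffeomorph.apply_symm_apply] at e
    rw [BoundaryManifold.boundaryData_incl] at e
    exact e.symm
  have hzt : z ∈ (beltMap D k).boundaryTube.toHomeo.target := by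
    rw [HandleAttachingMap.mem_boundaryTube_target_iff, hzX]
    exact hy
  exact hzt

/-- **Belt coordinates of a belt-region point**: if `G₀ (bX.incl y)` lies in the range of the belt map of handle `k`
and `e^{2πiu}` is the angle of `β♭⁻¹ (T⁻¹ y)`, then `B (u, m) = y` for `m` its fibre coordinate.
[cite: Kosinski1993, VI §6] -/
theorem beltChartFlat_of_mem_range {y : bX.carrier} (hy : G₀ (bX.incl y) ∈ range (beltMap D k).toFun) {u : ℝ}
    (hu : circlePt u = ((beltMap D k).boundaryTube.toHomeo.symm
      (((BoundaryManifold.boundaryData 3 X).restrictDiffeomorph bX G₀.symm).symm y)).1) :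
    beltChartFlat bX G₀ D k (u, ((beltMap D k).boundaryTube.toHomeo.symm
      (((BoundaryManifold.boundaryData 3 X).restrictDiffeomorph bX G₀.symm).symm y)).2) = y := by
  have hzt := symm_mem_boundaryTube_target bX G₀ D k hy
  rw [beltChartFlat_apply]
  show (BoundaryManifold.boundaryData 3 X).restrictDiffeomorph bX G₀.symm ((beltMap D k).boundaryTube.toHomeo
    (circlePt u, ((beltMap D k).boundaryTube.toHomeo.symm
      (((BoundaryManifold.boundaryData 3 X).restrictDiffeomorph bX G₀.symm).symm y)).2)) = y
  rw [hu, Prod.mk.eta, (beltMap D k).boundaryTube.toHomeo.right_inv hzt, Diffeomorph.apply_symm_apply]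

/-- The fibre coordinate of a belt-region point has norm `< 1`. [folklore] -/
theorem norm_beltCoord_lt_one {y : bX.carrier} (hy : G₀ (bX.incl y) ∈ range (beltMap D k).toFun) :
    ‖((beltMap D k).boundaryTube.toHomeo.symm
      (((BoundaryManifold.boundaryData 3 X).restrictDiffeomorph bX G₀.symm).symm y)).2‖ < 1 := by
  have hzt := symm_mem_boundaryTube_target bX G₀ D k hy
  have hs := (beltMap D k).boundaryTube.toHomeo.map_target hzt
  rw [← Prod.mk.eta (p := (beltMap D k).boundaryTube.toHomeo.symm
    (((BoundaryManifold.boundaryData 3 X).restrictDiffeomorph bX G₀.symm).symm y))] at hs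
  exact (beltMap D k).boundaryTube.mem_source_iff.1 hs

omit [IsManifold (𝓡∂ 4) ∞ X] in
/-- The belt region `{y | G₀ (bX.incl y) ∈ range (beltMap D k)}` is open in `∂X₀`. [folklore] -/
theorem isOpen_beltRegion : IsOpen {y : bX.carrier | G₀ (bX.incl y) ∈ range (beltMap D k).toFun} :=
  (beltMap D k).isOpen_range.preimage (G₀.continuous.comp bX.isSmoothEmbedding.isEmbedding.continuous)

end BeltCoord

/-! ## §3 The transit of the seam-lift chart: lift identity and fibred clause -/

section Transit

variable {g n : ℕ} [Nonempty (bBase g).carrier] {h : Fin n → HandleAttachingMap 3 2 (Base g)}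
  {X₀ : Type} [TopologicalSpace X₀] [ChartedSpace (EuclideanHalfSpace 4) X₀]
  (bX : BoundaryData (𝓡∂ 4) X₀ (𝓡 3)) (Ψ : bX.carrier ≃ₘ⟮𝓡 3, 𝓡 3⟯ (bBase g).carrier)
  {X : Type} [TopologicalSpace X] [ChartedSpace (EuclideanHalfSpace 4) X] [IsManifold (𝓡∂ 4) ∞ X]
  [Nonempty (BoundaryManifold.boundaryData 3 X).carrier]
  (G₀ : X₀ ≃ₘ⟮𝓡∂ 4, 𝓡∂ 4⟯ X) (D : MultiAttachmentData h (𝓡∂ 4) X) (d : Fin n → ℂ) (k : Fin n)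

/-- The direction `d k · e^{iσ}` is a unit direction. [folklore] -/
theorem norm_dir_exp {c : ℂ} (hc : ‖c‖ = 1) (σ : ℝ) : ‖c * Complex.exp ((σ : ℂ) * Complex.I)‖ = 1 := by
  rw [norm_mul, hc, Complex.norm_exp_ofReal_mul_I, mul_one]

/-- **The seam-lift chart is read in `X` as the chart point**: `G₀ (bX.incl (Λ₀ p)) = D.jA (φ p)` (H4-8).
[cite: Kosinski1993, VI §6] -/
theorem G₀_incl_seamLiftChart {c : ℂ} (hc : ‖c‖ = 1) {φ : ℝ × ℝ × ℝ → Base g} {p : ℝ × ℝ × ℝ}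
    (hq : φ p ∈ page g c) (hoff : φ p ∈ coresComplement h) :
    G₀ (bX.incl (seamLiftChart bX Ψ G₀ D φ p)) = D.jA ⟨φ p, hoff⟩ :=
  G₀_incl_seamLiftPt bX Ψ G₀ D hc hq hoff

/-- **LIFT**: the flat belt chart at any angle lift of the transit is the seam-lift chart,
`B (u, (χ̂ p).2) = Λ₀ p` for `e^{2πiu} = (χ̂ p).1`, when `Λ₀ p` is in the belt region. [cite: Kosinski1993, VI §6] -/
theorem beltChartFlat_transit {φ : ℝ × ℝ × ℝ → Base g} {p : ℝ × ℝ × ℝ}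
    (hy : G₀ (bX.incl (seamLiftChart bX Ψ G₀ D φ p)) ∈ range (beltMap D k).toFun) {u : ℝ}
    (hu : circlePt u = (transit bX Ψ G₀ D k φ p).1) :
    beltChartFlat bX G₀ D k (u, (transit bX Ψ G₀ D k φ p).2) = seamLiftChart bX Ψ G₀ D φ p :=
  beltChartFlat_of_mem_range bX G₀ D k hy hu

/-- The fibre coordinate of the transit has norm `< 1` (belt region). [folklore] -/
theorem norm_transit_snd_lt_one {φ : ℝ × ℝ × ℝ → Base g} {p : ℝ × ℝ × ℝ}
    (hy : G₀ (bX.incl (seamLiftChart bX Ψ G₀ D φ p)) ∈ range (beltMap D k).toFun) :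
    ‖(transit bX Ψ G₀ D k φ p).2‖ < 1 :=
  norm_beltCoord_lt_one bX G₀ D k hy

/-- **FIBRED, raw form**: under the seam clause through `G₀`, at a box point of level `σ` (`|σ| ≤ η₁`) off the cores
whose seam lift is in the belt region, `conj (d k) · w (Ψ (B (u, (χ̂ p).2))) = t · e^{iσ}` with `t > 0`.
[cite: Kosinski1993, VI §6] -/
theorem conj_mul_w_beltChartFlat_transit (hd : ‖d k‖ = 1)
    (hseam : ∀ (y : bX.carrier) (a : ↥(coresComplement h)), G₀ (bX.incl y) = D.jA a →
      ∃ c : ℝ, 0 < c ∧ w g ((bBase g).incl (Ψ y)).1 = (c : ℂ) * w g (a : Base g).1)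
    {η₁ : ℝ} {φ : ℝ × ℝ × ℝ → Base g}
    (hφp : ∀ u r σ, σ ∈ Icc (-η₁) η₁ → φ (u, r, σ) ∈ page g (d k * Complex.exp ((σ : ℂ) * Complex.I)))
    {p : ℝ × ℝ × ℝ} (hσ : p.2.2 ∈ Icc (-η₁) η₁) (hoff : φ p ∈ coresComplement h)
    (hy : G₀ (bX.incl (seamLiftChart bX Ψ G₀ D φ p)) ∈ range (beltMap D k).toFun) {u : ℝ}
    (hu : circlePt u = (transit bX Ψ G₀ D k φ p).1) :
    ∃ t : ℝ, 0 < t ∧ (starRingEnd ℂ) (d k) *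
      w g ((bBase g).incl (Ψ (beltChartFlat bX G₀ D k (u, (transit bX Ψ G₀ D k φ p).2)))).1 =
        (t : ℂ) * Complex.exp ((p.2.2 : ℂ) * Complex.I) := by
  rw [beltChartFlat_transit bX Ψ G₀ D k hy hu]
  have hq : φ p ∈ page g (d k * Complex.exp ((p.2.2 : ℂ) * Complex.I)) := hφp p.1 p.2.1 p.2.2 hσ
  obtain ⟨t, ht, hw⟩ := w_seamLiftPt bX Ψ G₀ D hseam (norm_dir_exp hd p.2.2) hq hoff
  refine ⟨t / 2, by positivity, ?_⟩
  rw [seamLiftChart_apply, hw]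
  have hcc : (starRingEnd ℂ) (d k) * d k = 1 := by
    rw [Complex.conj_mul', hd]; norm_num
  calc (starRingEnd ℂ) (d k) * ((t : ℂ) * (d k * Complex.exp ((p.2.2 : ℂ) * Complex.I) / 2))
      = ((starRingEnd ℂ) (d k) * d k) * ((t : ℂ) / 2) * Complex.exp ((p.2.2 : ℂ) * Complex.I) := by ring
    _ = ((t / 2 : ℝ) : ℂ) * Complex.exp ((p.2.2 : ℂ) * Complex.I) := by rw [hcc]; push_cast; ring

/-- **FIBRED**: positive denominator of the belt slope and `Q (u, (χ̂ p).2) = σ` at the transit of a box point of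
level `σ`, `|σ| < π/2` (the chart levels are the belt levels). [cite: Kosinski1993, VI §6] -/
theorem beltLevel_transit (hd : ‖d k‖ = 1)
    (hseam : ∀ (y : bX.carrier) (a : ↥(coresComplement h)), G₀ (bX.incl y) = D.jA a →
      ∃ c : ℝ, 0 < c ∧ w g ((bBase g).incl (Ψ y)).1 = (c : ℂ) * w g (a : Base g).1)
    {η₁ : ℝ} {φ : ℝ × ℝ × ℝ → Base g}
    (hφp : ∀ u r σ, σ ∈ Icc (-η₁) η₁ → φ (u, r, σ) ∈ page g (d k * Complex.exp ((σ : ℂ) * Complex.I)))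
    {p : ℝ × ℝ × ℝ} (hσ : p.2.2 ∈ Icc (-η₁) η₁) (hσπ : |p.2.2| < Real.pi / 2) (hoff : φ p ∈ coresComplement h)
    (hy : G₀ (bX.incl (seamLiftChart bX Ψ G₀ D φ p)) ∈ range (beltMap D k).toFun) {u : ℝ}
    (hu : circlePt u = (transit bX Ψ G₀ D k φ p).1) :
    0 < ((starRingEnd ℂ) (d k) *
        w g ((bBase g).incl (Ψ (beltChartFlat bX G₀ D k (u, (transit bX Ψ G₀ D k φ p).2)))).1).re ∧
      beltLevel bX Ψ G₀ D d k (u, (transit bX Ψ G₀ D k φ p).2) = p.2.2 := by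
  obtain ⟨t, ht, hw⟩ := conj_mul_w_beltChartFlat_transit bX Ψ G₀ D d k hd hseam hφp hσ hoff hy hu
  have hlt := abs_lt.1 hσπ
  have hcos : 0 < Real.cos p.2.2 := Real.cos_pos_of_mem_Ioo ⟨by linarith, by linarith⟩
  have hre : ((t : ℂ) * Complex.exp ((p.2.2 : ℂ) * Complex.I)).re = t * Real.cos p.2.2 := by
    rw [Complex.re_ofReal_mul, Complex.exp_ofReal_mul_I_re]
  have him : ((t : ℂ) * Complex.exp ((p.2.2 : ℂ) * Complex.I)).im = t * Real.sin p.2.2 := by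
    rw [Complex.im_ofReal_mul, Complex.exp_ofReal_mul_I_im]
  refine ⟨by rw [hw, hre]; positivity, ?_⟩
  rw [beltLevel_apply, hw, hre, him, mul_div_mul_left _ _ ht.ne', ← Real.tan_eq_sin_div_cos,
    Real.arctan_tan hlt.1 hlt.2]

/-! ## §4 The transit is injective modulo the period -/

/-- Unit directions with arguments closer than `2π` and equal exponentials are equal. [folklore] -/
theorem eq_of_exp_mul_I_eq {σ σ' : ℝ} (h : Complex.exp ((σ : ℂ) * Complex.I) = Complex.exp ((σ' : ℂ) * Complex.I))
    (hlt : |σ - σ'| < 2 * Real.pi) : σ = σ' := by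
  by_contra hne
  have h1 : Complex.exp (((σ - σ' : ℝ) : ℂ) * Complex.I) = 1 := by
    push_cast
    rw [sub_mul, Complex.exp_sub, h, div_self (Complex.exp_ne_zero _)]
  exact exp_ofReal_mul_I_ne_one (sub_ne_zero.2 hne) hlt h1

/-- **INJECTIVE**: two box points off the cores, in the belt region, with the same transit have the same level and
the same chart point (so they agree modulo the period, by the level-wise injectivity of `φ`).
[cite: LeeSmoothManifolds2013, Thm. 4.25] -/
theorem transit_eq_transit (hd : ‖d k‖ = 1) {η₁ : ℝ} {φ : ℝ × ℝ × ℝ → Base g}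
    (hφp : ∀ u r σ, σ ∈ Icc (-η₁) η₁ → φ (u, r, σ) ∈ page g (d k * Complex.exp ((σ : ℂ) * Complex.I)))
    {p p' : ℝ × ℝ × ℝ} (hσ : p.2.2 ∈ Icc (-η₁) η₁) (hσ' : p'.2.2 ∈ Icc (-η₁) η₁)
    (hlt : |p.2.2 - p'.2.2| < 2 * Real.pi)
    (hoff : φ p ∈ coresComplement h) (hoff' : φ p' ∈ coresComplement h)
    (hy : G₀ (bX.incl (seamLiftChart bX Ψ G₀ D φ p)) ∈ range (beltMap D k).toFun)
    (hy' : G₀ (bX.incl (seamLiftChart bX Ψ G₀ D φ p')) ∈ range (beltMap D k).toFun)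
    (heq : transit bX Ψ G₀ D k φ p = transit bX Ψ G₀ D k φ p') :
    p.2.2 = p'.2.2 ∧ φ p = φ p' := by
  -- same seam lift
  have hΛ : seamLiftChart bX Ψ G₀ D φ p = seamLiftChart bX Ψ G₀ D φ p' := by
    have h1 := beltChartFlat_transit bX Ψ G₀ D k hy (circlePt_angA _)
    have h2 := beltChartFlat_transit bX Ψ G₀ D k hy' (circlePt_angA _)
    rw [← h1, ← h2, heq]
  -- same chart point
  have hj : D.jA ⟨φ p, hoff⟩ = D.jA ⟨φ p', hoff'⟩ := by
    rw [← G₀_incl_seamLiftChart bX Ψ G₀ D (norm_dir_exp hd p.2.2) (hφp p.1 p.2.1 p.2.2 hσ) hoff,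
      ← G₀_incl_seamLiftChart bX Ψ G₀ D (norm_dir_exp hd p'.2.2) (hφp p'.1 p'.2.1 p'.2.2 hσ') hoff', hΛ]
  have hφ : φ p = φ p' := congrArg Subtype.val (D.injective_jA hj)
  -- same level: the pages of `φ p`, `φ p'` have directions `d k e^{iσ}`, `d k e^{iσ'}`
  refine ⟨?_, hφ⟩
  have hw1 := (hφp p.1 p.2.1 p.2.2 hσ).2
  have hw2 := (hφp p'.1 p'.2.1 p'.2.2 hσ').2
  have e1 : φ (p.1, p.2.1, p.2.2) = φ p := rfl
  have e2 : φ (p'.1, p'.2.1, p'.2.2) = φ p' := rfl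
  rw [e1] at hw1
  rw [e2, ← hφ, hw1] at hw2
  have hdk : d k ≠ 0 := fun h0 => by rw [h0, norm_zero] at hd; exact zero_ne_one hd
  have hexp : Complex.exp ((p.2.2 : ℂ) * Complex.I) = Complex.exp ((p'.2.2 : ℂ) * Complex.I) :=
    mul_left_cancel₀ hdk ((div_left_inj' two_ne_zero).1 hw2)
  exact eq_of_exp_mul_I_eq hexp hlt

end Transit

/-! ## §5 The registered package -/

section Package

/-- **Sub-goal `helper_beltGlue_transit` of stub `stub_M2geo`** (N1 ▸ `node_N1_move` ▸ (d) N1-mono, geometric dictionary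
of piece (d5); wave 8, lead c5).  THE TRANSIT OF THE SEAM-LIFT CHART IN BELT COORDINATES: in the telescope of
`node_N1_move` (seam clause through `G₀`), for the input chart family `φ` of (d) (level `σ ⊂ page (d k e^{iσ})` for
`|σ| ≤ η₁`), at every box point `p = (u', r', σ)` (`|σ| < η₁`, `|σ| < π/2`) off the cores whose seam lift `Λ₀ p` lies in
the belt region of handle `k`, and every angle lift `u` of `(χ̂ p).1`: LIFT `B (u, (χ̂ p).2) = Λ₀ p` with `‖(χ̂ p).2‖ < 1`;
FIBRED: positive denominator and belt level `Q (u, (χ̂ p).2) = σ`; INJECTIVE: equal transits force equal levels and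
equal chart points. [cite: Kosinski1993, VI §6] -/
theorem helper_beltGlue_transit : ∀ (g n : ℕ) [Nonempty (Literature.Topology.FourManifolds.LefschetzBase.bBase g).carrier] (h : Fin n → Literature.Topology.FourManifolds.HandleAttachingMap 3 2 (Literature.Topology.FourManifolds.LefschetzBase.Base g)) (X₀ : Type) [TopologicalSpace X₀] [ChartedSpace (EuclideanHalfSpace 4) X₀] (bX : Literature.Topology.FourManifolds.BoundaryData (𝓡∂ 4) X₀ (𝓡 3)) (Ψ : bX.carrier ≃ₘ⟮𝓡 3, 𝓡 3⟯ (Literature.Topology.FourManifolds.LefschetzBase.bBase g).carrier) (X : Type) [TopologicalSpace X] [ChartedSpace (EuclideanHalfSpace 4) X] [IsManifold (𝓡∂ 4) ∞ X] [Nonempty (Literature.Topology.FourManifolds.BoundaryManifold.boundaryData 3 X).carrier] (G₀ : X₀ ≃ₘ⟮𝓡∂ 4, 𝓡∂ 4⟯ X) (D : Literature.Topology.FourManifolds.HandleAttachingMap.MultiAttachmentData h (𝓡∂ 4) X) (d : Fin n → ℂ) (k : Fin n) (η₁ : ℝ) (φ : ℝ × ℝ × ℝ → Literature.Topology.FourManifolds.LefschetzBase.Base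 g), ‖d k‖ = 1 → (∀ (y : bX.carrier) (a : ↥(Literature.Topology.FourManifolds.HandleAttachingMap.coresComplement h)), G₀ (bX.incl y) = D.jA a → ∃ c : ℝ, 0 < c ∧ Literature.Topology.FourManifolds.LefschetzBase.w g ((Literature.Topology.FourManifolds.LefschetzBase.bBase g).incl (Ψ y)).1 = (c : ℂ) * Literature.Topology.FourManifolds.LefschetzBase.w g (a : Literature.Topology.FourManifolds.LefschetzBase.Base g).1) → (∀ u r σ, σ ∈ Set.Icc (-η₁) η₁ → φ (u, r, σ) ∈ Literature.Topology.FourManifolds.LefschetzBase.page g (d k * Complex.exp ((σ : ℂ) * Complex.I))) → ∀ (u' r' σ u : ℝ), σ ∈ Set.Ioo (-η₁) η₁ → |σ| < Real.pi / 2 → φ (u', r', σ) ∈ Literature.Topology.FourManifolds.HandleAttachingMap.coresComplement h → G₀ (bX.incl (Summit.SmoothPoincare4.SmoothPoincare4.Theorems.AcyclicBisectionExists.ModpBraidOrbits.seamLiftChart bX Ψ G₀ D φ (u', r', σ))) ∈ Set.range (Summit.SmoothPoincare4.SmoothPoincare4.Theorems.AcyclicBisectionExists.ModpBraidOrbits.beltMap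 D k).toFun → Literature.Topology.FourManifolds.circlePt u = (Summit.SmoothPoincare4.SmoothPoincare4.Theorems.AcyclicBisectionExists.ModpBraidOrbits.transit bX Ψ G₀ D k φ (u', r', σ)).1 → Summit.SmoothPoincare4.SmoothPoincare4.Theorems.AcyclicBisectionExists.ModpBraidOrbits.beltChartFlat bX G₀ D k (u, (Summit.SmoothPoincare4.SmoothPoincare4.Theorems.AcyclicBisectionExists.ModpBraidOrbits.transit bX Ψ G₀ D k φ (u', r', σ)).2) = Summit.SmoothPoincare4.SmoothPoincare4.Theorems.AcyclicBisectionExists.ModpBraidOrbits.seamLiftChart bX Ψ G₀ D φ (u', r', σ) ∧ ‖(Summit.SmoothPoincare4.SmoothPoincare4.Theorems.AcyclicBisectionExists.ModpBraidOrbits.transit bX Ψ G₀ D k φ (u', r', σ)).2‖ < 1 ∧ 0 < ((starRingEnd ℂ) (d k) * Literature.Topology.FourManifolds.LefschetzBase.w g ((Literature.Topology.FourManifolds.LefschetzBase.bBase g).incl (Ψ (Summit.SmoothPoincare4.SmoothPoincare4.Theorems.AcyclicBisectionExists.ModpBraidOrbits.beltChartFlat bX G₀ D k (u, (Summit.SmoothPoincare4.SmoothPoincare4.Theorems.AcyclicBisectionExists.ModpBraidOrbits.transit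 bX Ψ G₀ D k φ (u', r', σ)).2)))).1).re ∧ Summit.SmoothPoincare4.SmoothPoincare4.Theorems.AcyclicBisectionExists.ModpBraidOrbits.beltLevel bX Ψ G₀ D d k (u, (Summit.SmoothPoincare4.SmoothPoincare4.Theorems.AcyclicBisectionExists.ModpBraidOrbits.transit bX Ψ G₀ D k φ (u', r', σ)).2) = σ ∧ (∀ (u'' r'' σ' : ℝ), σ' ∈ Set.Ioo (-η₁) η₁ → |σ - σ'| < 2 * Real.pi → φ (u'', r'', σ') ∈ Literature.Topology.FourManifolds.HandleAttachingMap.coresComplement h → G₀ (bX.incl (Summit.SmoothPoincare4.SmoothPoincare4.Theorems.AcyclicBisectionExists.ModpBraidOrbits.seamLiftChart bX Ψ G₀ D φ (u'', r'', σ'))) ∈ Set.range (Summit.SmoothPoincare4.SmoothPoincare4.Theorems.AcyclicBisectionExists.ModpBraidOrbits.beltMap D k).toFun → Summit.SmoothPoincare4.SmoothPoincare4.Theorems.AcyclicBisectionExists.ModpBraidOrbits.transit bX Ψ G₀ D k φ (u', r', σ) = Summit.SmoothPoincare4.SmoothPoincare4.Theorems.AcyclicBisectionExists.ModpBraidOrbits.transit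 bX Ψ G₀ D k φ (u'', r'', σ') → σ = σ' ∧ φ (u', r', σ) = φ (u'', r'', σ')) := by
  intro g n _ h X₀ _ _ bX Ψ X _ _ _ _ G₀ D d k η₁ φ hd hseam hφp u' r' σ u hσ hσπ hoff hy hu
  have hσc : ((u', r', σ) : ℝ × ℝ × ℝ).2.2 ∈ Icc (-η₁) η₁ := ⟨hσ.1.le, hσ.2.le⟩
  refine ⟨beltChartFlat_transit bX Ψ G₀ D k hy hu, norm_transit_snd_lt_one bX Ψ G₀ D k hy,
    (beltLevel_transit bX Ψ G₀ D d k hd hseam hφp hσc hσπ hoff hy hu).1,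
    (beltLevel_transit bX Ψ G₀ D d k hd hseam hφp hσc hσπ hoff hy hu).2, fun u'' r'' σ' hσ₂ hlt hoff' hy' heq => ?_⟩
  exact transit_eq_transit bX Ψ G₀ D d k hd hφp (p := (u', r', σ)) (p' := (u'', r'', σ')) hσc
    ⟨hσ₂.1.le, hσ₂.2.le⟩ hlt hoff hoff' hy hy' heq

end Package

end Summit.SmoothPoincare4.SmoothPoincare4.Theorems.AcyclicBisectionExists.ModpBraidOrbits

end
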